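import Mathlib
import Summits.QuantumFields.YangMills.Theorems.BalabanUVNodesN15BackgroundGaugeSpecies
import HarnessLib

/-!
# Route «BalabanUVNodes» (cluster K4 «SpineRates»), Track-A DAG node N15 = spine estimate NE2, BACKGROUND LAYER — `T4EtaRate.NE2PlusOperator` BY NAME WITH
# THE GAUGE FIELD LIVE (abelian scalar model): the four (3.42) entries of the background-dependent pair whose first-order perturbation is DERIVED from the
# configuration `A′` through the exponential species, under the guard, per index with explicit constants, and for any family

Cell `pub-ymgap`, seat `pub-ymgap-dag-n15-b` (generation g5; FIRST-MISSING-ESTIMATE, HUMAN RULING D-0062; chair R424 venue; ROSTER-D0062 l.26).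
`bears_on: R4∕N15`.  Filed `--supports stmt-QuantumFields-19676` (K3; helper).  Imports part C1 `…N15.BackgroundLayer` (`gaugeBg`, `gcoef`, `gacoef`, `gavg`,
`gaugeInstance`, `gauge_letters_of_reg335`) and through it B1–B4 (`bgPair`, `bgSourceV`, `bgDerivedV`, `stack`, `unstack`, `hasMaj_idef_bgPropV`,
`hasMaj_idef_bgSourceV`, `hasMaj_idef_bgDerivedV`, `hasMaj_projO_comp`, `poly0_le`, `bgConst`, `bgConst1`) BY NAME; nothing in the tree is modified.

THE POINT (ref-B READ-348: *«G(U) with U live»*).  The configuration is the GAUGE FIELD `A′` (abelian scalar model, `U′ = e^{iη′A′}`), regular in the sense of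
the (3.35) letter pair; the perturbation `V′ = D_{U′} − ∇′ = Σ_μ [M_{η′phi1(η′,A′_μ)}∘∇′_μ + M_{phi1(η′,A′_μ)}]` is DERIVED from it (part C1), the coarse run's from the
block-averaged field; the background-dependent pair `(X(U), ∇_μX(U))_μ = (1 − Ĝ∘V̂(U))⁻¹Ĝ` is CONSTRUCTED (B1b), and ALL FOUR (3.42) entry operators of its
η-difference are bounded under the printed guard `M ≥ M₅`, `M·α₀ ≤ a₀` with the letters read off `Reg335` — so `NE2PlusOperator` holds BY NAME for a family
on which `U` is LIVE in the gauge-field sense (not only through abstract coefficients), the ONLY displayed hypotheses being the NE2⁰ operator layer of the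
`U ≡ 1` pieces.

CONTENTS ([folklore] bookkeeping; 3 defs).
* §1 `gc35 J c₃₅ = (2e+2)(1+|J|)²c₃₅` (the effective (3.35) constant of the derived coefficients); **`hasMaj_gauge_entries`** — per index, per regular `A′`: the
  four entry defects `≤ K·θ·e^{−(δ−σ)d}` with `K ∈ {bgConst, bgConst1}(β, c_r, m₀, gc35, a₀)` under `M ≥ 1`, `α₀ > 0`, `M·α₀ ≤ a₀`, `c₃₅a₀ ≤ 1`,
  `β·(gc35·a₀)·c_r ≤ ½`, spacings `η′ ≤ η ≤ min(1, θ)`.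
* §2 `gaugeOps4`, `gaugeFamily4`; **`etaRateIneq342_gauge`** (per index, `B₀ = bgConst + bgConst1`, `δ₀ = δ − σ`); **`ne2PlusOperator_gauge`** (any family;
  `M₅ := 1`, `a₀ := (2·gc35·(βc_r + 1))⁻¹`).

HONEST FRAMING ∕ LIMITS.  ABELIAN SCALAR MODEL of the covariant structure (the print's `exp(iη ad_A)` is the matrix species — parts 13b∕14∕18, not wired); the
`U ≡ 1` layer (pieces `G, ∇_μG, G∇*, ∇_μG∇*, ΔG` at both spacings and their η-defects with rate number `θ ≥ η`) DISPLAYED; linearised transport of the gauge field;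
sites of size `≥ 1`; the guard reads the datum's `M` (by-name statement live iff the family has unbounded `M`; the per-index theorem is the unconditional
content); nothing about Bałaban's `G(U)` of [B6]∕[B9] asserted.  NE2⁺ NOT PRINTED, NOT proved; count-neutral (typed 28∕28; nothing discharged); N15 NOT
discharged; one finite lattice at fixed ε — NOT infinite volume, NOT OS on ℝ⁴, NOT a mass gap, NOT Clay.
-/

noncomputable section

namespace Summit.QuantumFields.YangMills.BalabanUVNodes.N15.BackgroundLayer

open Literature.MathematicalPhysics.QuantumFieldTheory.Balaban1983to89
open Literature.MathematicalPhysics.QuantumFieldTheory.Balaban1983to89.B11SectG (BlockNorm HasMaj RowSum)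
open Literature.MathematicalPhysics.QuantumFieldTheory.Balaban1983to89.T4EtaRate (PairedInstance EtaRateIneq342 NE2PlusOperator rateFactor)
open Literature.MathematicalPhysics.QuantumFieldTheory.Balaban1983to89.T4EtaRateDefect (idef rateWeight)
open Literature.MathematicalPhysics.QuantumFieldTheory.Balaban1983to89.T4EtaRateCoeffDefect (pull)
open Literature.MathematicalPhysics.QuantumFieldTheory.Balaban1983to89.B6RandomWalk (Triangle254)
open Literature.MathematicalPhysics.QuantumFieldTheory.Balaban1983to89.B9SectDSup (inv_one_sub_le_two)
open Summit.QuantumFields.YangMills.BalabanUVNodes.N15.OperatorReadout (opGeo opFamily opGeo_len rateFactor_opGeo etaRateIneq342_of_hasMaj)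

/-! ## §1 The four entries of the gauge-species pair under the guard -/

section Guard

variable {X X' J : Type} [Fintype X] [Fintype X'] [Fintype J] [DecidableEq X] [DecidableEq X'] [DecidableEq J] {g : B6.Geometry}
  (blk : X → g.Site) (π : X' → X)

/-- THE EFFECTIVE (3.35) CONSTANT of the derived coefficients: `(2e + 2)(1 + |J|)²·c₃₅` (so the stacked sup letter is `gc35·M·α₀`). [folklore] -/
def gc35 (J : Type) [Fintype J] (c35 : ℝ) : ℝ := (2 * Real.exp 1 + 2) * (1 + Fintype.card J) * (1 + Fintype.card J) * c35

omit [Fintype X] [Fintype X'] [DecidableEq X] [DecidableEq X'] [DecidableEq J] in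
/-- `c₃₅ ≤ gc35` and `0 < gc35` for `c₃₅ > 0`. [folklore] -/
theorem le_gc35 {c35 : ℝ} (hc35 : 0 < c35) : c35 ≤ gc35 J c35 ∧ 0 < gc35 J c35 := by
  have he : (1 : ℝ) ≤ 2 * Real.exp 1 + 2 := by linarith [Real.exp_nonneg (1 : ℝ)]
  have hJ : (1 : ℝ) ≤ 1 + Fintype.card J := le_add_of_nonneg_right (Nat.cast_nonneg _)
  have h1 : (1 : ℝ) ≤ (2 * Real.exp 1 + 2) * (1 + Fintype.card J) * (1 + Fintype.card J) := by
    have := mul_le_mul he hJ zero_le_one (zero_le_one.trans he)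
    nlinarith
  unfold gc35
  constructor
  · nlinarith
  · positivity

variable {G S D₃ : (X → ℝ) →ₗ[ℝ] (X → ℝ)} {D SD : J → (X → ℝ) →ₗ[ℝ] (X → ℝ)} {G' S' D₃' : (X' → ℝ) →ₗ[ℝ] (X' → ℝ)}
  {D' SD' : J → (X' → ℝ) →ₗ[ℝ] (X' → ℝ)}

/-- **THE FOUR ENTRY DEFECTS OF THE GAUGE-SPECIES PAIR UNDER THE GUARD.**  `U ≡ 1` layer: `G, D_μ, S, SD_μ` (coarse) and `G′, D′_μ, D₃′` (fine) `≤ β·e^{−δd}`, the five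
η-defects `≤ m₀·θ·e^{−δd}`, `σ ≤ δ`; spacings `0 ≤ η′ ≤ η ≤ 1`, `η ≤ θ`; guard `c₃₅ > 0`, `a₀ ≥ 0`, `c₃₅a₀ ≤ 1`, `β·(gc35·a₀)·c_r ≤ ½`, `M ≥ 1`, `α₀ > 0`, `M·α₀ ≤ a₀`;
gauge field `A′` with `(gaugeBg J π M θ).Reg335 c₃₅ α₀ A′`.  With the derived coefficients `c′ = gcoef η′ A′`, `a′ = gacoef η′ A′`, `c̄ = gcoef η Ā`, `ā = gacoef η Ā`,
`Ā = gavg A′`: entries 0∕1 (components `j` of the pair), entry 2 (source step, stacked source `(S, SD_μ)`), entry 3 (derived object of `D₃`) have majorants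
`K·θ·e^{−(δ−σ)d}`, `K = bgConst` (entries 0∕1∕2), `bgConst1` (entry 3) at `(β, c_r, m₀, gc35, a₀)`. [cite: Balaban1985BackgroundPropagators, Thm 3.1 (3.42) p.397 (quantifier template, entries: shapes); (3.35) p.396, (3.50) p.400, (3.63)–(3.65) pp.402–403 (shapes, mechanism)] -/
theorem hasMaj_gauge_entries (htri : Triangle254 g) (hd : ∀ a b : g.Site, 0 ≤ g.dist a b) {σ cr : ℝ} (hσ : 0 ≤ σ) (hcr : 0 ≤ cr) (hrow : RowSum g σ cr)
    {δ β m₀ θ c35 a₀ M α₀ η η' : ℝ} (hσδ : σ ≤ δ) (hβ : 0 ≤ β) (hm₀ : 0 ≤ m₀) (hθ : 0 ≤ θ) (hc35 : 0 < c35) (ha₀ : 0 ≤ a₀) (ha₀1 : c35 * a₀ ≤ 1)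
    (hq : β * (gc35 J c35 * a₀) * cr ≤ 1 / 2) (hM : 1 ≤ M) (hα₀ : 0 < α₀) (hMα : M * α₀ ≤ a₀)
    (hη' : 0 ≤ η') (hη'η : η' ≤ η) (hη1 : η ≤ 1) (hηθ : η ≤ θ)
    (hG : HasMaj (BlockNorm.ofBlocks g blk) (BlockNorm.ofBlocks g blk) G (fun y y' => β * Real.exp (-(δ * g.dist y y'))))
    (hD : ∀ μ, HasMaj (BlockNorm.ofBlocks g blk) (BlockNorm.ofBlocks g blk) (D μ) (fun y y' => β * Real.exp (-(δ * g.dist y y'))))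
    (hG' : HasMaj (BlockNorm.ofBlocks g (blk ∘ π)) (BlockNorm.ofBlocks g (blk ∘ π)) G' (fun y y' => β * Real.exp (-(δ * g.dist y y'))))
    (hD' : ∀ μ, HasMaj (BlockNorm.ofBlocks g (blk ∘ π)) (BlockNorm.ofBlocks g (blk ∘ π)) (D' μ) (fun y y' => β * Real.exp (-(δ * g.dist y y'))))
    (hS : HasMaj (BlockNorm.ofBlocks g blk) (BlockNorm.ofBlocks g blk) S (fun y y' => β * Real.exp (-(δ * g.dist y y'))))
    (hSD : ∀ μ, HasMaj (BlockNorm.ofBlocks g blk) (BlockNorm.ofBlocks g blk) (SD μ) (fun y y' => β * Real.exp (-(δ * g.dist y y'))))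
    (hD₃' : HasMaj (BlockNorm.ofBlocks g (blk ∘ π)) (BlockNorm.ofBlocks g (blk ∘ π)) D₃' (fun y y' => β * Real.exp (-(δ * g.dist y y'))))
    (hDG : HasMaj (BlockNorm.ofBlocks g blk) (BlockNorm.ofBlocks g (blk ∘ π)) (idef (pull π) (pull π) G' G)
      (fun y y' => m₀ * θ * Real.exp (-(δ * g.dist y y'))))
    (hDD : ∀ μ, HasMaj (BlockNorm.ofBlocks g blk) (BlockNorm.ofBlocks g (blk ∘ π)) (idef (pull π) (pull π) (D' μ) (D μ))
      (fun y y' => m₀ * θ * Real.exp (-(δ * g.dist y y'))))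
    (hDS : HasMaj (BlockNorm.ofBlocks g blk) (BlockNorm.ofBlocks g (blk ∘ π)) (idef (pull π) (pull π) S' S)
      (fun y y' => m₀ * θ * Real.exp (-(δ * g.dist y y'))))
    (hDSD : ∀ μ, HasMaj (BlockNorm.ofBlocks g blk) (BlockNorm.ofBlocks g (blk ∘ π)) (idef (pull π) (pull π) (SD' μ) (SD μ))
      (fun y y' => m₀ * θ * Real.exp (-(δ * g.dist y y'))))
    (hDD₃ : HasMaj (BlockNorm.ofBlocks g blk) (BlockNorm.ofBlocks g (blk ∘ π)) (idef (pull π) (pull π) D₃' D₃)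
      (fun y y' => m₀ * θ * Real.exp (-(δ * g.dist y y'))))
    {A' : J → X' → ℝ} (hreg : (gaugeBg J π M θ).Reg335 c35 α₀ A') :
    (∀ j : Option J, HasMaj (BlockNorm.ofBlocks g blk) (BlockNorm.ofBlocks g (blk ∘ π))
      (idef (pull π) (pull π) (projO j ∘ₗ bgPair G' D' (gcoef η' A') (gacoef η' A'))
        (projO j ∘ₗ bgPair G D (gcoef η (gavg J π A')) (gacoef η (gavg J π A'))))
      (fun y y' => bgConst β cr m₀ (gc35 J c35) a₀ * θ * Real.exp (-((δ - σ) * g.dist y y')))) ∧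
    HasMaj (BlockNorm.ofBlocks g blk) (BlockNorm.ofBlocks g (blk ∘ π))
      (idef (pull π) (pull π) (projO none ∘ₗ bgSourceV (stack G' D') (stack S' SD') (unstack (gcoef η' A') (gacoef η' A')))
        (projO none ∘ₗ bgSourceV (stack G D) (stack S SD) (unstack (gcoef η (gavg J π A')) (gacoef η (gavg J π A')))))
      (fun y y' => bgConst β cr m₀ (gc35 J c35) a₀ * θ * Real.exp (-((δ - σ) * g.dist y y'))) ∧
    HasMaj (BlockNorm.ofBlocks g blk) (BlockNorm.ofBlocks g (blk ∘ π))
      (idef (pull π) (pull π) (bgDerivedV (stack G' D') D₃' (unstack (gcoef η' A') (gacoef η' A')))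
        (bgDerivedV (stack G D) D₃ (unstack (gcoef η (gavg J π A')) (gacoef η (gavg J π A')))))
      (fun y y' => bgConst1 β cr m₀ (gc35 J c35) a₀ * θ * Real.exp (-((δ - σ) * g.dist y y'))) := by
  obtain ⟨hr₁0, hr₁a, hV, hV', hDV⟩ := gauge_letters_of_reg335 (g := g) (J := J) blk π hη' hη'η hη1 hηθ hc35 hM hα₀ hMα ha₀1 hreg
  -- the stacked sup letter `R` and its guard bound
  set R : ℝ := (2 * Real.exp 1 + 2) * (1 + Fintype.card J) * (c35 * M * α₀) * (1 + Fintype.card J) with hR_def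
  have hJ0 : (0 : ℝ) ≤ 1 + Fintype.card J := by positivity
  have hR0 : 0 ≤ R := mul_nonneg hr₁0 hJ0
  have hRa : R ≤ gc35 J c35 * a₀ := by
    calc R ≤ (2 * Real.exp 1 + 2) * (1 + Fintype.card J) * c35 * a₀ * (1 + Fintype.card J) := mul_le_mul_of_nonneg_right hr₁a hJ0
      _ = gc35 J c35 * a₀ := by unfold gc35; ring
  have hq' : β * R * cr ≤ 1 / 2 := (mul_le_mul_of_nonneg_right (mul_le_mul_of_nonneg_left hRa hβ) hcr).trans hq
  have hq1 : β * R * cr < 1 := by linarith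
  have hinv : (1 - β * R * cr)⁻¹ ≤ 2 := inv_one_sub_le_two hq'
  have hinv0 : 0 ≤ (1 - β * R * cr)⁻¹ := inv_nonneg.2 (by linarith)
  have hRθ : (2 * Real.exp 1 + 2) * (1 + Fintype.card J) * (c35 * M * α₀) * θ * (1 + Fintype.card J) = R * θ := by rw [hR_def]; ring
  rw [hRθ] at hDV
  -- the U ≡ 1 layer, stacked
  have hβe : ∀ y y' : g.Site, 0 ≤ β * Real.exp (-(δ * g.dist y y')) := fun _ _ => mul_nonneg hβ (Real.exp_nonneg _)
  have hme : ∀ y y' : g.Site, 0 ≤ m₀ * θ * Real.exp (-(δ * g.dist y y')) := fun _ _ => mul_nonneg (mul_nonneg hm₀ hθ) (Real.exp_nonneg _)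
  have hSG := hasMaj_stack blk hβe hG hD
  have hSG' := hasMaj_stack (blk ∘ π) hβe hG' hD'
  have hSS := hasMaj_stack blk hβe hS hSD
  have hSDG : HasMaj (BlockNorm.ofBlocks g blk) (BlockNorm.ofBlocks g (blkPair (blk ∘ π)))
      (idef (pull π) (pull (liftPair π)) (stack G' D') (stack G D)) (fun y y' => m₀ * θ * Real.exp (-(δ * g.dist y y'))) := by
    rw [idef_stack]; exact hasMaj_stack (blk ∘ π) hme hDG hDD
  have hSDS : HasMaj (BlockNorm.ofBlocks g blk) (BlockNorm.ofBlocks g (blkPair (blk ∘ π)))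
      (idef (pull π) (pull (liftPair π)) (stack S' SD') (stack S SD)) (fun y y' => m₀ * θ * Real.exp (-(δ * g.dist y y'))) := by
    rw [idef_stack]; exact hasMaj_stack (blk ∘ π) hme hDS hDSD
  have hRθ0 : 0 ≤ R * θ := mul_nonneg hR0 hθ
  -- the common polynomial bound (entries 0∕1∕2) and the derived-entry bound (entry 3)
  set u : ℝ := (1 - β * R * cr)⁻¹ with hu_def
  have h0 := poly0_le (β := β) (cr := cr) (m₀ := m₀) (θ := θ) (c35 := gc35 J c35) (a₀ := a₀) (r := R) (u := u) hβ hcr hm₀ hθ hR0 hRa hinv0 hinv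
  have hE : ∀ a b : g.Site, 0 ≤ Real.exp (-((δ - σ) * g.dist a b)) := fun _ _ => Real.exp_nonneg _
  refine ⟨fun j => ?_, ?_, ?_⟩
  · -- entries 0∕1: B1a on the stacked pair, then the component
    have key := hasMaj_idef_bgPropV blk (blkPair blk) π (liftPair π) htri hd hσ hcr hrow (ρ := δ - σ) (by linarith) (by linarith) hβ hR0 hRθ0
      (mul_nonneg hm₀ hθ) hSG hSG' hSDG hV hV' hDV hq1
    have keyj := hasMaj_projO_comp (blk ∘ π) key j
    have hcomp : idef (pull π) (pull π) (projO j ∘ₗ bgPair G' D' (gcoef η' A') (gacoef η' A'))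
        (projO j ∘ₗ bgPair G D (gcoef η (gavg J π A')) (gacoef η (gavg J π A'))) =
        projO j ∘ₗ idef (pull π) (pull (liftPair π)) (bgPropV (stack G' D') (unstack (gcoef η' A') (gacoef η' A')))
          (bgPropV (stack G D) (unstack (gcoef η (gavg J π A')) (gacoef η (gavg J π A')))) :=
      LinearMap.ext fun v => funext fun x' => rfl
    rw [hcomp]
    refine keyj.mono fun a b => ?_
    simp only [one_mul]
    exact mul_le_mul_of_nonneg_right h0 (hE a b)
  · -- entry 2: the source step over the stacks, `none` component
    have key := hasMaj_idef_bgSourceV blk (blkPair blk) π (liftPair π) htri hd hσ hcr hrow (ρ := δ - σ) (by linarith) (by linarith) hβ hR0 hRθ0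
      (mul_nonneg hm₀ hθ) (mul_nonneg hm₀ hθ) hSG hSG' hSS hSDG hSDS hV hV' hDV hq1
    have keyj := hasMaj_projO_comp (blk ∘ π) key none
    have hcomp : idef (pull π) (pull π) (projO none ∘ₗ bgSourceV (stack G' D') (stack S' SD') (unstack (gcoef η' A') (gacoef η' A')))
        (projO none ∘ₗ bgSourceV (stack G D) (stack S SD) (unstack (gcoef η (gavg J π A')) (gacoef η (gavg J π A')))) =
        projO none ∘ₗ idef (pull π) (pull (liftPair π)) (bgSourceV (stack G' D') (stack S' SD') (unstack (gcoef η' A') (gacoef η' A')))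
          (bgSourceV (stack G D) (stack S SD) (unstack (gcoef η (gavg J π A')) (gacoef η (gavg J π A')))) :=
      LinearMap.ext fun v => funext fun x' => rfl
    rw [hcomp]
    refine keyj.mono fun a b => ?_
    simp only [one_mul, mul_one]
    exact mul_le_mul_of_nonneg_right h0 (hE a b)
  · -- entry 3: the derived object of `D₃` over the stacked propagator
    have key := hasMaj_idef_bgDerivedV blk (blkPair blk) π (liftPair π) htri hd hσ hcr hrow (ρ := δ - σ) (by linarith) (by linarith) hβ hR0 hRθ0
      (mul_nonneg hm₀ hθ) (mul_nonneg hm₀ hθ) hSG hSG' hD₃' hSDG hDD₃ hV hV' hDV hq1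
    refine key.mono fun a b => ?_
    simp only [one_mul]
    refine mul_le_mul_of_nonneg_right ?_ (hE a b)
    have hgc : 0 ≤ gc35 J c35 := (le_gc35 (J := J) hc35).2.le
    have hgca : 0 ≤ gc35 J c35 * a₀ := mul_nonneg hgc ha₀
    have h2 : m₀ * θ * cr * (R * (β * u)) ≤ m₀ * θ * cr * (gc35 J c35 * a₀ * (β * 2)) := by gcongr
    have h3 : β * R * cr * ((m₀ * θ * cr + m₀ * θ * cr * (R * (β * u)) + β * (R * θ) * (β * u) * cr) * u) ≤
        1 / 2 * (bgConst β cr m₀ (gc35 J c35) a₀ * θ) := mul_le_mul hq' h0 (by positivity) (by norm_num)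
    have h4 : β * (R * θ) * (β * u) * cr ≤ β * (gc35 J c35 * a₀ * θ) * (β * 2) * cr := by gcongr
    calc m₀ * θ * cr + m₀ * θ * cr * (R * (β * u)) +
          β * R * cr * ((m₀ * θ * cr + m₀ * θ * cr * (R * (β * u)) + β * (R * θ) * (β * u) * cr) * u) + β * (R * θ) * (β * u) * cr
        ≤ m₀ * θ * cr + m₀ * θ * cr * (gc35 J c35 * a₀ * (β * 2)) + 1 / 2 * (bgConst β cr m₀ (gc35 J c35) a₀ * θ) +
          β * (gc35 J c35 * a₀ * θ) * (β * 2) * cr := add_le_add (add_le_add (add_le_add le_rfl h2) h3) h4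
      _ = bgConst1 β cr m₀ (gc35 J c35) a₀ * θ := by unfold bgConst1; ring

end Guard

/-! ## §2 The kernel family, `EtaRateIneq342` per index, `NE2PlusOperator` BY NAME with the gauge field live -/

section Readout

variable {X X' J : Type} [Fintype X] [Fintype X'] [Fintype J] [DecidableEq X] [DecidableEq X'] [DecidableEq J] {g : B6.Geometry}
  (blk : X → g.Site) (π : X' → X)

/-- THE FOUR ENTRY OPERATORS at a gauge field `A′` (fine spacing `η′`, coarse spacing `η`): all CONSTRUCTED from the `U ≡ 1` pieces and the DERIVED coefficients.
[cite: Balaban1985BackgroundPropagators, (3.42) p.397 (the four entries: shape); (3.50) p.400 (covariant derivative: shape)] -/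
def gaugeOps4 (η η' : ℝ) (ν : J) (G S D₃ : (X → ℝ) →ₗ[ℝ] (X → ℝ)) (D SD : J → (X → ℝ) →ₗ[ℝ] (X → ℝ)) (G' S' D₃' : (X' → ℝ) →ₗ[ℝ] (X' → ℝ))
    (D' SD' : J → (X' → ℝ) →ₗ[ℝ] (X' → ℝ)) : Fin 4 → (J → X' → ℝ) → ((X → ℝ) →ₗ[ℝ] (X' → ℝ)) :=
  fun n A' => ![idef (pull π) (pull π) (projO none ∘ₗ bgPair G' D' (gcoef η' A') (gacoef η' A'))
      (projO none ∘ₗ bgPair G D (gcoef η (gavg J π A')) (gacoef η (gavg J π A'))),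
    idef (pull π) (pull π) (projO (some ν) ∘ₗ bgPair G' D' (gcoef η' A') (gacoef η' A'))
      (projO (some ν) ∘ₗ bgPair G D (gcoef η (gavg J π A')) (gacoef η (gavg J π A'))),
    idef (pull π) (pull π) (projO none ∘ₗ bgSourceV (stack G' D') (stack S' SD') (unstack (gcoef η' A') (gacoef η' A')))
      (projO none ∘ₗ bgSourceV (stack G D) (stack S SD) (unstack (gcoef η (gavg J π A')) (gacoef η (gavg J π A')))),
    idef (pull π) (pull π) (bgDerivedV (stack G' D') D₃' (unstack (gcoef η' A') (gacoef η' A')))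
      (bgDerivedV (stack G D) D₃ (unstack (gcoef η (gavg J π A')) (gacoef η (gavg J π A'))))] n

/-- THE KERNEL FAMILY over the gauge-field carrier (g0 `opFamily`), spacings `η = g.eta`, `η′ = η·(L^n)⁻¹`. [cite: Balaban1985BackgroundPropagators, (3.42) p.397 (shape)] -/
def gaugeFamily4 (n : ℕ) (hL : g.L ≠ 0) (θc θ : ℝ) (ν : J) (G S D₃ : (X → ℝ) →ₗ[ℝ] (X → ℝ)) (D SD : J → (X → ℝ) →ₗ[ℝ] (X → ℝ))
    (G' S' D₃' : (X' → ℝ) →ₗ[ℝ] (X' → ℝ)) (D' SD' : J → (X' → ℝ) →ₗ[ℝ] (X' → ℝ)) :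
    B9.KernelFamily (gaugeInstance J blk π n hL θc θ).gc (gaugeInstance J blk π n hL θc θ).Bf :=
  show B9.KernelFamily (opGeo g X blk) (gaugeBg J π g.M θ) from
    opFamily (g := g) (B := gaugeBg J π g.M θ) blk (blk ∘ π) (gaugeOps4 π g.eta (g.eta * (g.L ^ n)⁻¹) ν G S D₃ D SD G' S' D₃' D' SD')

variable {G S D₃ : (X → ℝ) →ₗ[ℝ] (X → ℝ)} {D SD : J → (X → ℝ) →ₗ[ℝ] (X → ℝ)} {G' S' D₃' : (X' → ℝ) →ₗ[ℝ] (X' → ℝ)}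
  {D' SD' : J → (X' → ℝ) →ₗ[ℝ] (X' → ℝ)}

/-- **`EtaRateIneq342` PER INDEX, GAUGE FIELD LIVE, EXPLICIT CONSTANTS** (`B₀ = bgConst + bgConst1` at `gc35`, `δ₀ = δ − σ`), for every `Reg335`-regular `A′` under
the guard. [cite: Balaban1985BackgroundPropagators, Thm 3.1 (3.42) p.397 (shape, quantifier template)] -/
theorem etaRateIneq342_gauge (htri : Triangle254 g) (hd : ∀ a b : g.Site, 0 ≤ g.dist a b) {σ cr : ℝ} (hσ : 0 ≤ σ) (hcr : 0 ≤ cr) (hrow : RowSum g σ cr)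
    (hη : 0 < g.eta) (hL : 0 < g.L) (hlen : ∀ y, 1 ≤ g.len y) {δ β m₀ θ c35 a₀ M α₀ γ η' : ℝ}
    (hσδ : σ ≤ δ) (hβ : 0 ≤ β) (hm₀ : 0 ≤ m₀) (hθ : 0 ≤ θ) (hθγ : ∀ y, θ ≤ rateWeight g γ y) (hc35 : 0 < c35) (ha₀ : 0 ≤ a₀) (ha₀1 : c35 * a₀ ≤ 1)
    (hq : β * (gc35 J c35 * a₀) * cr ≤ 1 / 2) (hM : 1 ≤ M) (hα₀ : 0 < α₀) (hMα : M * α₀ ≤ a₀)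
    (hη' : 0 ≤ η') (hη'η : η' ≤ g.eta) (hη1 : g.eta ≤ 1) (hηθ : g.eta ≤ θ) {ν : J}
    (hG : HasMaj (BlockNorm.ofBlocks g blk) (BlockNorm.ofBlocks g blk) G (fun y y' => β * Real.exp (-(δ * g.dist y y'))))
    (hD : ∀ μ, HasMaj (BlockNorm.ofBlocks g blk) (BlockNorm.ofBlocks g blk) (D μ) (fun y y' => β * Real.exp (-(δ * g.dist y y'))))
    (hG' : HasMaj (BlockNorm.ofBlocks g (blk ∘ π)) (BlockNorm.ofBlocks g (blk ∘ π)) G' (fun y y' => β * Real.exp (-(δ * g.dist y y'))))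
    (hD' : ∀ μ, HasMaj (BlockNorm.ofBlocks g (blk ∘ π)) (BlockNorm.ofBlocks g (blk ∘ π)) (D' μ) (fun y y' => β * Real.exp (-(δ * g.dist y y'))))
    (hS : HasMaj (BlockNorm.ofBlocks g blk) (BlockNorm.ofBlocks g blk) S (fun y y' => β * Real.exp (-(δ * g.dist y y'))))
    (hSD : ∀ μ, HasMaj (BlockNorm.ofBlocks g blk) (BlockNorm.ofBlocks g blk) (SD μ) (fun y y' => β * Real.exp (-(δ * g.dist y y'))))
    (hD₃' : HasMaj (BlockNorm.ofBlocks g (blk ∘ π)) (BlockNorm.ofBlocks g (blk ∘ π)) D₃' (fun y y' => β * Real.exp (-(δ * g.dist y y'))))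
    (hDG : HasMaj (BlockNorm.ofBlocks g blk) (BlockNorm.ofBlocks g (blk ∘ π)) (idef (pull π) (pull π) G' G)
      (fun y y' => m₀ * θ * Real.exp (-(δ * g.dist y y'))))
    (hDD : ∀ μ, HasMaj (BlockNorm.ofBlocks g blk) (BlockNorm.ofBlocks g (blk ∘ π)) (idef (pull π) (pull π) (D' μ) (D μ))
      (fun y y' => m₀ * θ * Real.exp (-(δ * g.dist y y'))))
    (hDS : HasMaj (BlockNorm.ofBlocks g blk) (BlockNorm.ofBlocks g (blk ∘ π)) (idef (pull π) (pull π) S' S)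
      (fun y y' => m₀ * θ * Real.exp (-(δ * g.dist y y'))))
    (hDSD : ∀ μ, HasMaj (BlockNorm.ofBlocks g blk) (BlockNorm.ofBlocks g (blk ∘ π)) (idef (pull π) (pull π) (SD' μ) (SD μ))
      (fun y y' => m₀ * θ * Real.exp (-(δ * g.dist y y'))))
    (hDD₃ : HasMaj (BlockNorm.ofBlocks g blk) (BlockNorm.ofBlocks g (blk ∘ π)) (idef (pull π) (pull π) D₃' D₃)
      (fun y y' => m₀ * θ * Real.exp (-(δ * g.dist y y'))))
    {A' : J → X' → ℝ} (hreg : (gaugeBg J π M θ).Reg335 c35 α₀ A') :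
    EtaRateIneq342 (opFamily (g := g) (B := gaugeBg J π M θ) blk (blk ∘ π) (gaugeOps4 π g.eta η' ν G S D₃ D SD G' S' D₃' D' SD'))
      (bgConst β cr m₀ (gc35 J c35) a₀ + bgConst1 β cr m₀ (gc35 J c35) a₀) (δ - σ) γ A' := by
  obtain ⟨h01, h2, h3⟩ := hasMaj_gauge_entries blk π htri hd hσ hcr hrow hσδ hβ hm₀ hθ hc35 ha₀ ha₀1 hq hM hα₀ hMα hη' hη'η hη1 hηθ hG hD hG' hD' hS hSD
    hD₃' hDG hDD hDS hDSD hDD₃ hreg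
  have hgc : 0 ≤ gc35 J c35 := (le_gc35 (J := J) hc35).2.le
  have hC0 : 0 ≤ bgConst β cr m₀ (gc35 J c35) a₀ := bgConst_nonneg hβ hcr hm₀ hgc ha₀
  have hC1 : 0 ≤ bgConst1 β cr m₀ (gc35 J c35) a₀ := bgConst1_nonneg hβ hcr hm₀ hgc ha₀
  have hB₀ : 0 ≤ bgConst β cr m₀ (gc35 J c35) a₀ + bgConst1 β cr m₀ (gc35 J c35) a₀ := add_nonneg hC0 hC1
  refine etaRateIneq342_of_hasMaj (g := g) (B := gaugeBg J π M θ) blk (blk ∘ π) hη.le hL.le hB₀ (gaugeOps4 π g.eta η' ν G S D₃ D SD G' S' D₃' D' SD') A'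
    fun n => ?_
  have hdom : ∀ {B : ℝ}, 0 ≤ B → B ≤ bgConst β cr m₀ (gc35 J c35) a₀ + bgConst1 β cr m₀ (gc35 J c35) a₀ → ∀ y y' : g.Site,
      B * θ * Real.exp (-((δ - σ) * g.dist y y')) ≤
        (bgConst β cr m₀ (gc35 J c35) a₀ + bgConst1 β cr m₀ (gc35 J c35) a₀) * B9.pref4 ((opGeo g X blk).len y) n *
          Real.exp (-((δ - σ) * g.dist y y')) * max (rateFactor (opGeo g X blk) γ y) (rateFactor (opGeo g X blk) γ y') := by
    intro B hB0 hB y y'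
    have hpref : 1 ≤ B9.pref4 ((opGeo g X blk).len y) n := by rw [opGeo_len]; exact one_le_pref4 (hlen y) n
    have hrf : θ ≤ max (rateFactor (opGeo g X blk) γ y) (rateFactor (opGeo g X blk) γ y') := by
      rw [rateFactor_opGeo g X blk hη.ne' hL γ y']
      exact (hθγ y').trans (le_max_right _ _)
    have hE : 0 ≤ Real.exp (-((δ - σ) * g.dist y y')) := Real.exp_nonneg _
    calc B * θ * Real.exp (-((δ - σ) * g.dist y y'))
        ≤ ((bgConst β cr m₀ (gc35 J c35) a₀ + bgConst1 β cr m₀ (gc35 J c35) a₀) * B9.pref4 ((opGeo g X blk).len y) n) * θ *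
            Real.exp (-((δ - σ) * g.dist y y')) := by
          refine mul_le_mul_of_nonneg_right (mul_le_mul_of_nonneg_right ?_ hθ) hE
          calc B = B * 1 := (mul_one B).symm
            _ ≤ _ := mul_le_mul hB hpref zero_le_one hB₀
      _ = (bgConst β cr m₀ (gc35 J c35) a₀ + bgConst1 β cr m₀ (gc35 J c35) a₀) * B9.pref4 ((opGeo g X blk).len y) n *
            Real.exp (-((δ - σ) * g.dist y y')) * θ := by ring
      _ ≤ _ := mul_le_mul_of_nonneg_left hrf (mul_nonneg (mul_nonneg hB₀ (zero_le_one.trans hpref)) hE)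
  fin_cases n
  · exact (h01 none).mono (hdom hC0 (le_add_of_nonneg_right hC1))
  · exact (h01 (some ν)).mono (hdom hC0 (le_add_of_nonneg_right hC1))
  · exact h2.mono (hdom hC0 (le_add_of_nonneg_right hC1))
  · exact h3.mono (hdom hC1 (le_add_of_nonneg_left hC0))

end Readout

section Node

variable {I J : Type} [Fintype J] [DecidableEq J] (g : I → B6.Geometry) (X X' : I → Type) [∀ i, Fintype (X i)] [∀ i, Fintype (X' i)]
  [∀ i, DecidableEq (X i)] [∀ i, DecidableEq (X' i)] (blk : ∀ i, X i → (g i).Site) (π : ∀ i, X' i → X i) (nsh : I → ℕ) (hL0 : ∀ i, (g i).L ≠ 0)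
  (θc θ : I → ℝ) (ν : I → J) (G S D₃ : ∀ i, (X i → ℝ) →ₗ[ℝ] (X i → ℝ)) (D SD : ∀ i, J → (X i → ℝ) →ₗ[ℝ] (X i → ℝ))
  (G' S' D₃' : ∀ i, (X' i → ℝ) →ₗ[ℝ] (X' i → ℝ)) (D' SD' : ∀ i, J → (X' i → ℝ) →ₗ[ℝ] (X' i → ℝ))

/-- **NE2⁺, OPERATOR LAYER — `T4EtaRate.NE2PlusOperator` BY NAME WITH THE GAUGE FIELD LIVE (abelian scalar model), ALL FOUR ENTRIES CONSTRUCTED, ONLY THE `U ≡ 1`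
LAYER DISPLAYED.**  For ANY family — [B6] carriers with (2.54), `d ≥ 0`, uniform (2.61) `(σ, c_r)`, `0 < η ≤ min(1, θ_i)`, `L ≥ 1`, sites of size `≥ 1`; a fixed direction
set `J`; the `U ≡ 1` LAYER with UNIFORM letters (majorants `β·e^{−δd}`, `σ < δ`, of `G, ∇_μG, G∇*, ∇_μG∇*` coarse and `G′, ∇′_μG′, Δ′G′` fine; η-defects `m₀·θ_i·e^{−δd}`
of the five pairs; `θ_i ≤ (L^j)^{−γ}`, `γ > 0`); `c₃₅ > 0` —: the realised instances over the GAUGE-FIELD carriers (configurations `A′`, `Reg335` = the (3.35)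
letter pair per component, transport = block average, guard = the datum's `M`) with the kernel families `gaugeFamily4` (perturbation DERIVED from `A′` by the
exponential species) satisfy `NE2PlusOperator c₃₅`, with `M₅ = 1`, `a₀ = (2·gc35·(βc_r + 1))⁻¹`, `B₀ = bgConst + bgConst1 + 1`, `δ₀ = δ − σ`; (3.35) is CONSUMED
on the gauge field itself. [cite: Balaban1985BackgroundPropagators, Thm 3.1 p.397 (quantifier template); (3.35) p.396, (3.42) + (3.44) p.397, (3.50)–(3.52) p.400, (3.63)–(3.65) pp.402–403 (shapes, mechanism)] -/
theorem ne2PlusOperator_gauge (c35 : ℝ) (hc35 : 0 < c35)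
    (htri : ∀ i, Triangle254 (g i)) (hd : ∀ i (a b : (g i).Site), 0 ≤ (g i).dist a b) {σ cr : ℝ} (hσ : 0 ≤ σ) (hcr : 0 ≤ cr)
    (hrow : ∀ i, RowSum (g i) σ cr) (hη : ∀ i, 0 < (g i).eta) (hη1 : ∀ i, (g i).eta ≤ 1) (hηθ : ∀ i, (g i).eta ≤ θ i) (hL : ∀ i, 1 ≤ (g i).L)
    (hlen : ∀ i y, 1 ≤ (g i).len y) {δ β m₀ γ : ℝ} (hσδ : σ < δ) (hβ : 0 ≤ β) (hm₀ : 0 ≤ m₀) (hγ : 0 < γ) (hθγ : ∀ i y, θ i ≤ rateWeight (g i) γ y)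
    (hG : ∀ i, HasMaj (BlockNorm.ofBlocks (g i) (blk i)) (BlockNorm.ofBlocks (g i) (blk i)) (G i) (fun y y' => β * Real.exp (-(δ * (g i).dist y y'))))
    (hD : ∀ i μ, HasMaj (BlockNorm.ofBlocks (g i) (blk i)) (BlockNorm.ofBlocks (g i) (blk i)) (D i μ)
      (fun y y' => β * Real.exp (-(δ * (g i).dist y y'))))
    (hG' : ∀ i, HasMaj (BlockNorm.ofBlocks (g i) (blk i ∘ π i)) (BlockNorm.ofBlocks (g i) (blk i ∘ π i)) (G' i)
      (fun y y' => β * Real.exp (-(δ * (g i).dist y y'))))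
    (hD' : ∀ i μ, HasMaj (BlockNorm.ofBlocks (g i) (blk i ∘ π i)) (BlockNorm.ofBlocks (g i) (blk i ∘ π i)) (D' i μ)
      (fun y y' => β * Real.exp (-(δ * (g i).dist y y'))))
    (hS : ∀ i, HasMaj (BlockNorm.ofBlocks (g i) (blk i)) (BlockNorm.ofBlocks (g i) (blk i)) (S i) (fun y y' => β * Real.exp (-(δ * (g i).dist y y'))))
    (hSD : ∀ i μ, HasMaj (BlockNorm.ofBlocks (g i) (blk i)) (BlockNorm.ofBlocks (g i) (blk i)) (SD i μ)
      (fun y y' => β * Real.exp (-(δ * (g i).dist y y'))))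
    (hD₃' : ∀ i, HasMaj (BlockNorm.ofBlocks (g i) (blk i ∘ π i)) (BlockNorm.ofBlocks (g i) (blk i ∘ π i)) (D₃' i)
      (fun y y' => β * Real.exp (-(δ * (g i).dist y y'))))
    (hDG : ∀ i, HasMaj (BlockNorm.ofBlocks (g i) (blk i)) (BlockNorm.ofBlocks (g i) (blk i ∘ π i)) (idef (pull (π i)) (pull (π i)) (G' i) (G i))
      (fun y y' => m₀ * θ i * Real.exp (-(δ * (g i).dist y y'))))
    (hDD : ∀ i μ, HasMaj (BlockNorm.ofBlocks (g i) (blk i)) (BlockNorm.ofBlocks (g i) (blk i ∘ π i))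
      (idef (pull (π i)) (pull (π i)) (D' i μ) (D i μ)) (fun y y' => m₀ * θ i * Real.exp (-(δ * (g i).dist y y'))))
    (hDS : ∀ i, HasMaj (BlockNorm.ofBlocks (g i) (blk i)) (BlockNorm.ofBlocks (g i) (blk i ∘ π i)) (idef (pull (π i)) (pull (π i)) (S' i) (S i))
      (fun y y' => m₀ * θ i * Real.exp (-(δ * (g i).dist y y'))))
    (hDSD : ∀ i μ, HasMaj (BlockNorm.ofBlocks (g i) (blk i)) (BlockNorm.ofBlocks (g i) (blk i ∘ π i))
      (idef (pull (π i)) (pull (π i)) (SD' i μ) (SD i μ)) (fun y y' => m₀ * θ i * Real.exp (-(δ * (g i).dist y y'))))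
    (hDD₃ : ∀ i, HasMaj (BlockNorm.ofBlocks (g i) (blk i)) (BlockNorm.ofBlocks (g i) (blk i ∘ π i)) (idef (pull (π i)) (pull (π i)) (D₃' i) (D₃ i))
      (fun y y' => m₀ * θ i * Real.exp (-(δ * (g i).dist y y')))) :
    NE2PlusOperator c35 (fun i => gaugeInstance J (blk i) (π i) (nsh i) (hL0 i) (θc i) (θ i))
      (fun i => gaugeFamily4 (blk i) (π i) (nsh i) (hL0 i) (θc i) (θ i) (ν i) (G i) (S i) (D₃ i) (D i) (SD i) (G' i) (S' i) (D₃' i) (D' i) (SD' i)) := by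
  obtain ⟨hcg, hgpos⟩ := le_gc35 (J := J) hc35
  -- the guard constant: `β·(gc35·a₀)·c_r ≤ ½` and `c₃₅a₀ ≤ 1`
  set a₀ : ℝ := (2 * gc35 J c35 * (β * cr + 1))⁻¹ with ha₀_def
  have hden : 0 < 2 * gc35 J c35 * (β * cr + 1) := by positivity
  have ha₀ : 0 < a₀ := inv_pos.2 hden
  have hq : β * (gc35 J c35 * a₀) * cr ≤ 1 / 2 := by
    have h1 : β * (gc35 J c35 * a₀) * cr = (β * cr) * (gc35 J c35 * a₀) := by ring
    have h2 : gc35 J c35 * a₀ = (2 * (β * cr + 1))⁻¹ := by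
      rw [ha₀_def]; field_simp
    rw [h1, h2, ← div_eq_mul_inv, div_le_iff₀ (by positivity)]
    nlinarith [mul_nonneg hβ hcr]
  have ha₀1 : c35 * a₀ ≤ 1 := by
    rw [ha₀_def, ← div_eq_mul_inv, div_le_one hden]
    nlinarith [mul_nonneg hβ hcr, hgpos]
  have hC0 : 0 ≤ bgConst β cr m₀ (gc35 J c35) a₀ := bgConst_nonneg hβ hcr hm₀ hgpos.le ha₀.le
  have hC1 : 0 ≤ bgConst1 β cr m₀ (gc35 J c35) a₀ := bgConst1_nonneg hβ hcr hm₀ hgpos.le ha₀.le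
  refine ⟨1, δ - σ, a₀, bgConst β cr m₀ (gc35 J c35) a₀ + bgConst1 β cr m₀ (gc35 J c35) a₀ + 1, γ, one_pos, by linarith, ha₀, by linarith, hγ,
    fun i hM α₀ hα₀ hMα A' hreg => ?_⟩
  have hM' : 1 ≤ (g i).M := hM
  have hMα' : (g i).M * α₀ ≤ a₀ := hMα
  have hLpos : 0 < (g i).L := lt_of_lt_of_le one_pos (hL i)
  -- the fine spacing `η′ = η·(L^n)⁻¹ ≤ η`
  have hη'0 : 0 ≤ (g i).eta * ((g i).L ^ nsh i)⁻¹ := mul_nonneg (hη i).le (inv_nonneg.2 (pow_nonneg hLpos.le _))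
  have hη'η : (g i).eta * ((g i).L ^ nsh i)⁻¹ ≤ (g i).eta := by
    have h1 : ((g i).L ^ nsh i)⁻¹ ≤ 1 := inv_le_one_of_one_le₀ (one_le_pow₀ (hL i))
    calc (g i).eta * ((g i).L ^ nsh i)⁻¹ ≤ (g i).eta * 1 := mul_le_mul_of_nonneg_left h1 (hη i).le
      _ = (g i).eta := mul_one _
  have hθ0 : 0 ≤ θ i := (hη i).le.trans (hηθ i)
  have key := etaRateIneq342_gauge (J := J) (blk i) (π i) (htri i) (hd i) hσ hcr (hrow i) (hη i) hLpos (hlen i) hσδ.le hβ hm₀ hθ0 (hθγ i) hc35 ha₀.le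
    ha₀1 hq hM' hα₀ hMα' hη'0 hη'η (hη1 i) (hηθ i) (ν := ν i) (hG i) (hD i) (hG' i) (hD' i) (hS i) (hSD i) (hD₃' i) (hDG i) (hDD i) (hDS i) (hDSD i)
    (hDD₃ i) hreg
  intro n lam y y' hs
  refine (key n lam y y' hs).trans ?_
  have hpref : 0 ≤ B9.pref4 ((gaugeInstance J (blk i) (π i) (nsh i) (hL0 i) (θc i) (θ i)).gc.len y) n := by
    have : 1 ≤ B9.pref4 ((opGeo (g i) (X i) (blk i)).len y) n := by rw [opGeo_len]; exact one_le_pref4 (hlen i y) n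
    exact zero_le_one.trans this
  have hrf : 0 ≤ max (rateFactor (gaugeInstance J (blk i) (π i) (nsh i) (hL0 i) (θc i) (θ i)).gc γ y)
      (rateFactor (gaugeInstance J (blk i) (π i) (nsh i) (hL0 i) (θc i) (θ i)).gc γ y') :=
    (T4EtaRate.rateFactor_nonneg (g := opGeo (g i) (X i) (blk i)) (hη i).le hLpos.le γ y).trans (le_max_left _ _)
  have hnorm : 0 ≤ (gaugeInstance J (blk i) (π i) (nsh i) (hL0 i) (θc i) (θ i)).gc.supNorm lam := Real.iSup_nonneg fun x => abs_nonneg _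
  have hE : 0 ≤ Real.exp (-((δ - σ) * (gaugeInstance J (blk i) (π i) (nsh i) (hL0 i) (θc i) (θ i)).gc.dist y y')) := Real.exp_nonneg _
  exact mul_le_mul_of_nonneg_right (mul_le_mul_of_nonneg_right (mul_le_mul_of_nonneg_right
    (mul_le_mul_of_nonneg_right (le_add_of_nonneg_right zero_le_one) hpref) hE) hrf) hnorm

end Node

end Summit.QuantumFields.YangMills.BalabanUVNodes.N15.BackgroundLayer
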